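import Mathlib
import HarnessLib
import Literature.Geometry.Lorentzian.KerrConvergence
import Summits.FinalStateConjecture.FinalStateConjecture.Theorems.LogTimeThreeAnnuliDyadicCaptureDefs

/-!
# Route LogTimeThreeAnnuli · crux `DyadicCapture` — stub 6a: Kerr–Schild exteriors depend on `a²` only

Helper for the rechart stubs 6a/6b of the line `registered` of the crux
`Summit.FinalStateConjecture.FinalStateConjecture.Theses.LogTimeThreeAnnuli.DyadicCapture`
(stmt-FinalStateConjecture-17488). The analysis of stub 6a (`stub_horizonNormalisedRestriction`, crux
item notes, 2026-08-17) reduces the honest rechart to the case in which the frozen member `(Mᵢ, aᵢ)`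
and the reference parameters `(d.mass i, d.spin i)` have THE SAME horizon ellipsoid,
`Mᵢ = d.mass i` and `|aᵢ| = |d.spin i|`; the rechart is then a relabeling, because every set the
reference chart system is built on depends on the spin through `a²` only. This file records that
algebra: for `|a| = |s|` the Kerr–Schild radius functions `r_a = r_s`, the horizon radii
`r₊(M, a) = r₊(M, s)`, the exteriors `{r_a > r₊(M, a)} = {r_s > r₊(M, s)}` and the boosted exteriors
agree (`horizonRestriction_kerrSchild_eq_of_abs_eq`). Kerr, PRL 11 (1963) (the radius quartic
`r⁴ − (ρ² − a²) r² − a² z² = 0`); O'Neill 1995, Ch. 2, §2.3 (`r₊ = M + √(M² − a²)`).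
-/

-- the `Summit.FinalStateConjecture.FinalStateConjecture.…` namespace repeats the summit = sub-problem
-- segment (D-0017 layout, CONVENTIONS §2); the duplicate is deliberate.
set_option linter.dupNamespace false

noncomputable section

namespace Summit.FinalStateConjecture.FinalStateConjecture.Theorems

open Literature.Geometry.Lorentzian
open scoped Topology Manifold ENNReal ContDiff
open Filter Set

/-- The Kerr–Schild radius depends on the spin through `a²` only: `|a| = |s| → r_a = r_s`
(the defining quartic `r⁴ − (ρ² − a²) r² − a² z² = 0`; Visser arXiv:0706.0622, (35)). [cite: arXiv07060622, (35)] -/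
theorem horizonRestriction_radius_eq_of_abs_eq {a s : ℝ} (h : |a| = |s|) :
    Kerr.radius a = Kerr.radius s := by
  have h2 : a ^ 2 = s ^ 2 := by rw [← sq_abs a, h, sq_abs]
  funext x
  unfold Kerr.radius
  rw [h2]

/-- The outer horizon radius depends on the spin through `a²` only: `|a| = |s| → r₊(M, a) = r₊(M, s)`
(O'Neill 1995, Ch. 2, §2.3). [cite: ONeill1995, Ch. 2  §2.3] -/
theorem horizonRestriction_rPlus_eq_of_abs_eq (M : ℝ) {a s : ℝ} (h : |a| = |s|) :
    Kerr.rPlus M a = Kerr.rPlus M s := by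
  have h2 : a ^ 2 = s ^ 2 := by rw [← sq_abs a, h, sq_abs]
  unfold Kerr.rPlus
  rw [h2]

/-- **Kerr–Schild exteriors depend on `a²` only** (relabeling algebra for the honest rechart of the
line `registered`): for `|a| = |s|`, the radius functions, the outer horizon radii, the Kerr exteriors
`{r > r₊}` and the boosted exteriors `boostedKerrExterior Λ c M ·` of `a` and `s` coincide.
[cite: ONeill1995, Ch. 2  §2.3] -/
theorem horizonRestriction_kerrSchild_eq_of_abs_eq : ∀ (Λ : lorentzGroup) (c : E4) (M a s : ℝ), |a| = |s| → Kerr.radius a = Kerr.radius s ∧ Kerr.rPlus M a = Kerr.rPlus M s ∧ Kerr.exterior M a = Kerr.exterior M s ∧ boostedKerrExterior Λ c M a = boostedKerrExterior Λ c M s := by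
  intro Λ c M a s h
  have hr := horizonRestriction_radius_eq_of_abs_eq h
  have hp := horizonRestriction_rPlus_eq_of_abs_eq M h
  have he : Kerr.exterior M a = Kerr.exterior M s := by
    ext x
    simp only [SetLike.mem_coe, Kerr.mem_exterior, hr, hp]
  refine ⟨hr, hp, he, ?_⟩
  ext x
  simp only [SetLike.mem_coe, mem_boostedKerrExterior, he]

end Summit.FinalStateConjecture.FinalStateConjecture.Theorems

end
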